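import Summits.ValiantsHypothesis.ValiantsHypothesis.Theorems.LacunarySymmetroidMatrixDescartesStubDetLorentzian
import Summits.ValiantsHypothesis.ValiantsHypothesis.Theorems.LacunarySymmetroidMatrixDescartesStubDetCurve
import Summits.ValiantsHypothesis.ValiantsHypothesis.Theorems.LacunarySymmetroidMatrixDescartesStubPerturbGeneric
import Summits.ValiantsHypothesis.ValiantsHypothesis.Theorems.LacunarySymmetroidMatrixDescartesStubSplit
import Summits.ValiantsHypothesis.ValiantsHypothesis.Theses.LacunarySymmetroid
import Summits.ValiantsHypothesis.ValiantsHypothesis.Theorems.LacunarySymmetroidMatrixDescartesCensusKLawBridge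
import Summits.ValiantsHypothesis.ValiantsHypothesis.Theorems.LacunarySymmetroidMatrixDescartesCensusFrame
import Summits.ValiantsHypothesis.ValiantsHypothesis.Theorems.LacunarySymmetroidMatrixDescartesShadowPathBound

/-!
# Crux `MatrixDescartes` (stmt-ValiantsHypothesis-18050) — line `lorentzian-shadow`
# (tropical / Newton-polytope lens at COEFFICIENT level; ideator val-idea-1, D-0148 (a), 2026-08-27)

HONEST FRAMING.  A skeleton over OPEN statements.  Every `stub_*` is `sorry`.  Nothing here asserts
`MatrixDescartes`, Conjecture B (`KPlusLogSqLaw`), a door, or anything about `VP ≠ VNP`; a law candidate does not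
move `VP ≠ VNP`.

## Idea (one lever)
After exponent splitting (line `sign-split`, stubs `stub_split`/`stub_perturb`, restated here δ-equally as
`stub_splitT8`/`stub_perturbT8`) the format-level law is a statement about pencils `Σ_l σ_l x^{e_l} A_l` with
`A_l ⪰ 0`, i.e. about the restriction of the polynomial `h(s) = det Σ_l s_l A_l` to a SIGNED MONOMIAL CURVE
`s_l = σ_l x^{e_l}`.  The lever of this line is the NEWTON POLYTOPE of `h` and its tropical geometry:
`h` is LORENTZIAN (Brändén–Huh, arXiv:1902.03719): nonnegative coefficients on an M-convex support (a generalized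
permutohedron) whose valuations under any real-closed non-archimedean degeneration form an M-CONVEX FUNCTION `ν`
(B–H, tropicalised Lorentzian polynomials = M-convex functions).  The `x`-Newton polygon of the restricted
polynomial is the lower SHADOW of `(⟨e,α⟩, ν(α))`; by GROSS SUBSTITUTABILITY of M♮-concave valuations
(Kelso–Crawford / Fujishige–Yang / Murota) every tail sum `Σ_{i ≥ k} α_i(u)` of the parametric minimiser is
monotone in the slope `u`, so the shadow has at most `m (K' − 1)` edges and total lattice length `≤ m (K' − 1)`
(`stub_shadowPath`, the line's FIRST RUNG, pure discrete convex analysis, decidable instances).  Consequences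
(informal, over a real closed field with convex valuation): positive roots of a split-class pencil take at most
`m (K' − 1)` distinct valuations, and a configuration whose valuation data are GENERIC (shadow cells are edges)
has EXACTLY `Σ_k c_k · [σ_{i_k} ≠ σ_{j_k}] ≤ m (K' − 1)` positive roots (edge initial forms are bivariate
Lorentzian = real-rooted, Hensel lifts them) — the tropical regime of the split class is exactly solvable and
LINEAR, so all super-linear root counts (staircase, Vinnikov `K = 3`, census towers `(m,4) ≥ m² + 2m > 7m`)
live in ARCHIMEDEAN CORES attached to non-edge shadow cells.  The LAW of the line is therefore posed on the
class that is closed under passing to initial forms on shadow cells — the LORENTZIAN class, strictly larger than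
the stable and the PSD-determinantal classes: `LorentzianDescartes` (B-shape bound `2^{C (K' + log₂² m)}` for the
signed monomial restriction of ANY Lorentzian polynomial).  Chain (kernel-checked below):
`LorentzianDescartes → DetLorentzian → DetCurve → (T8: PerturbToAlternation, SplitToSemidefinite) → KPlusLogSqLaw
→ MatrixDescartes` (last arrow = tree bridge `Census.matrixDescartes_of_kPlusLogSqLaw`).

Stubs (sorries ONLY here): `stub_lorentzianDescartes` (THE LAW, crux-level), `stub_detLorentzian` (KNOWN:
Borcea–Brändén Prop. 2.4 + Brändén–Huh "stable ⇒ Lorentzian"; formalisation M/L), `stub_detCurve` (algebra, S/M),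
`stub_perturbT8`, `stub_splitT8` (shared with line `sign-split`); `stub_shadowPath` (FIRST RUNG) is CLOSED by name
since 2026-08-27 (p584842, `Theorems/LacunarySymmetroidMatrixDescartesShadowPathBound.lean`) — 5 sorries remain.
`MatrixDescartes_of` concludes the crux BY NAME; `kPlusLogSqLaw_of` concludes B by name.
-/

set_option linter.dupNamespace false
set_option linter.unusedVariables false
set_option autoImplicit false

namespace Summit.ValiantsHypothesis.ValiantsHypothesis.Cruxes.MatrixDescartes.LorentzianShadow

open Polynomial Matrix Finset
open scoped BigOperators

open Summit.ValiantsHypothesis.ValiantsHypothesis.Theorems.LacunarySymmetroidMatrixDescartes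
open Summit.ValiantsHypothesis.ValiantsHypothesis.Theorems.MatrixDescartes.Negative (PosRootLawAt)

/-! ## Vocabulary (δ-equal to `Cruxes/MatrixDescartes/Lines/sign_split.lean`) -/

/-- The lacunary pencil `Σ_l X^{d_l} • S_l` (verbatim the crux's expression). -/
noncomputable def pencil {K m : ℕ} (d : Fin K → ℕ) (S : Fin K → Matrix (Fin m) (Fin m) ℝ) :
    Matrix (Fin m) (Fin m) ℝ[X] :=
  ∑ l, (X : ℝ[X]) ^ d l • (S l).map C

/-- Number of distinct POSITIVE real roots of a real polynomial. -/
noncomputable def posRoots (p : ℝ[X]) : ℕ := (p.roots.toFinset.filter (fun t => 0 < t)).card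

/-- `Z₊` of a pencil. -/
noncomputable def posRootCount {K m : ℕ} (d : Fin K → ℕ) (S : Fin K → Matrix (Fin m) (Fin m) ℝ) : ℕ :=
  posRoots (pencil d S).det

/-- Strict sign alternation of `det` of the pencil along positive test points. -/
def Alternates {K m : ℕ} (d : Fin K → ℕ) (S : Fin K → Matrix (Fin m) (Fin m) ℝ)
    (N : ℕ) (τ : Fin (N + 1) → ℝ) : Prop :=
  StrictMono τ ∧ (∀ j, 0 < τ j) ∧
    ∀ j : Fin N, (pencil d S).det.eval (τ j.castSucc) * (pencil d S).det.eval (τ j.succ) < 0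

/-- A signed family of matrices: `σ_l = true ↦ +A_l`, `false ↦ −A_l`. -/
noncomputable def signed {K m : ℕ} (σ : Fin K → Bool) (A : Fin K → Matrix (Fin m) (Fin m) ℝ) :
    Fin K → Matrix (Fin m) (Fin m) ℝ :=
  fun l => (if σ l then (1 : ℝ) else -1) • A l

/-- T8 perturbation lemma (δ-equal to `SignSplit.PerturbToAlternation`). -/
def PerturbToAlternation : Prop :=
  ∀ (K m : ℕ) (d : Fin K → ℕ) (B : ℕ),
    (∀ S : Fin K → Matrix (Fin m) (Fin m) ℝ, (∀ l, (S l).IsSymm) →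
        ∀ (N : ℕ) (τ : Fin (N + 1) → ℝ), Alternates d S N τ → N ≤ B) →
    ∀ S : Fin K → Matrix (Fin m) (Fin m) ℝ, (∀ l, (S l).IsSymm) → posRootCount d S ≤ 2 * B

/-- T8 exponent splitting (δ-equal to `SignSplit.SplitToSemidefinite`). -/
def SplitToSemidefinite : Prop :=
  ∀ (K m : ℕ) (d : Fin K → ℕ) (S : Fin K → Matrix (Fin m) (Fin m) ℝ), (∀ l, (S l).IsSymm) →
    ∀ (N : ℕ) (τ : Fin (N + 1) → ℝ), Alternates d S N τ →
      ∃ (K' : ℕ) (d' : Fin K' → ℕ) (σ : Fin K' → Bool) (A : Fin K' → Matrix (Fin m) (Fin m) ℝ),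
        K' ≤ 2 * K ∧ StrictMono d' ∧ (∀ l, (A l).PosSemidef) ∧ N ≤ posRootCount d' (signed σ A)

/-! ## The exponent layer `Δ(m,K)`, exchanges, M-convexity (Murota) -/

/-- `Δ(m,K) = {α : Fin K → ℕ | Σ α = m}` as a `Finset`. -/
def layer (m K : ℕ) : Finset (Fin K → ℕ) :=
  (Fintype.piFinset fun _ : Fin K => Finset.range (m + 1)).filter (fun α => ∑ i, α i = m)

/-- the exchange `α − e_i + e_j` (truncated subtraction; used only when `α i ≥ 1`). -/
def exch {K : ℕ} (α : Fin K → ℕ) (i j : Fin K) : Fin K → ℕ :=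
  α - Pi.single i 1 + Pi.single j 1

/-- **M-convex function on the finite set `D`** (exchange axiom, Murota): for `α, β ∈ D` and `i` with
`α i > β i` there is `j` with `α j < β j` such that both exchanges stay in `D` and
`ν(α − e_i + e_j) + ν(β − e_j + e_i) ≤ ν α + ν β`.  With `ν = 0` this says `D` is an M-convex SET. -/
def IsMConvexOn {K : ℕ} (D : Finset (Fin K → ℕ)) (ν : (Fin K → ℕ) → ℚ) : Prop :=
  ∀ α ∈ D, ∀ β ∈ D, ∀ i : Fin K, β i < α i →
    ∃ j : Fin K, α j < β j ∧ exch α i j ∈ D ∧ exch β j i ∈ D ∧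
      ν (exch α i j) + ν (exch β j i) ≤ ν α + ν β

/-- the weight `⟨e, α⟩` (exponent of `x` carried by the monomial `s^α` on the curve `s_l = ± x^{e_l}`). -/
def wt {K : ℕ} (e : Fin K → ℕ) (α : Fin K → ℕ) : ℕ := ∑ i, e i * α i

/-- `α` is a VERTEX of the lower shadow of `{(⟨e,β⟩, ν β) : β ∈ D}`: the strict unique minimiser of
`ν + u·⟨e,·⟩` for some slope `u` (= a vertex of the `x`-Newton polygon in the tropical model). -/
def IsShadowVertex {K : ℕ} (D : Finset (Fin K → ℕ)) (ν : (Fin K → ℕ) → ℚ) (e : Fin K → ℕ)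
    (α : Fin K → ℕ) : Prop :=
  α ∈ D ∧ ∃ u : ℚ, ∀ β ∈ D, β ≠ α → ν α + u * (wt e α : ℚ) < ν β + u * (wt e β : ℚ)

open Classical in
/-- number of shadow vertices. -/
noncomputable def shadowVertexCount {K : ℕ} (D : Finset (Fin K → ℕ)) (ν : (Fin K → ℕ) → ℚ)
    (e : Fin K → ℕ) : ℕ :=
  (D.filter (fun α => IsShadowVertex D ν e α)).card

/-- **FIRST RUNG — the M-convex shadow path bound.**  For an M-convex `ν` on `D ⊆ Δ(m,K)` and pairwise
distinct weights `e`, the lower shadow has at most `m (K − 1) + 1` vertices (so the tropical `x`-Newton polygon of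
a split-class / Lorentzian pencil has `≤ m (K − 1)` edges).  Proof plan: order coordinates by `e`; the parametric
minimiser `α(u)` of `ν + u⟨e,·⟩` is the demand of the M♮-concave valuation `−ν` at prices `u e`; normalising
prices at `e_k` and applying GROSS SUBSTITUTES twice, every tail sum `Σ_{i ≥ k} α_i(u)` is non-increasing in `u`;
the potential `Σ_k Σ_{i ≥ k} α_i ∈ [0, m (K−1)]` drops by `≥ 1` at every vertex change. [plan; Murota,
Discrete Convex Analysis (2003) Thm 6.? (M♮ ⇔ GS, Fujishige–Yang 2003); numerics: scratch/hull_mconvex.py,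
never exceeded on 300+326 random instances, attained for K = 3 and (2,4), (3,4)] -/
def ShadowPathBound : Prop :=
  ∀ (m K : ℕ) (D : Finset (Fin K → ℕ)) (ν : (Fin K → ℕ) → ℚ) (e : Fin K → ℕ),
    D ⊆ layer m K → IsMConvexOn D ν → Function.Injective e →
      shadowVertexCount D ν e ≤ m * (K - 1) + 1

/-! ## Lorentzian coefficient arrays (Brändén–Huh 2020, Def. 2.6, in coefficient form) -/

/-- `α! = Π_i (α_i)!` -/
def factWeight {K : ℕ} (α : Fin K → ℕ) : ℕ := ∏ i, (α i).factorial

/-- the Hessian block of `∂^γ h` for `h = Σ_α c_α s^α`: `H_γ(i,j) = (γ+e_i+e_j)! · c(γ+e_i+e_j)`. -/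
noncomputable def hessAt {K : ℕ} (c : (Fin K → ℕ) → ℝ) (γ : Fin K → ℕ) : Matrix (Fin K) (Fin K) ℝ :=
  fun i j => (factWeight (γ + Pi.single i 1 + Pi.single j 1) : ℝ) * c (γ + Pi.single i 1 + Pi.single j 1)

/-- "at most one positive eigenvalue" for a real symmetric matrix, in eigenvalue-free form: no 2-plane on
which the form is positive definite. -/
def AtMostOnePosEig {K : ℕ} (H : Matrix (Fin K) (Fin K) ℝ) : Prop :=
  ∀ v w : Fin K → ℝ, 0 < v ⬝ᵥ (H *ᵥ v) → (v ⬝ᵥ (H *ᵥ v)) * (w ⬝ᵥ (H *ᵥ w)) ≤ (v ⬝ᵥ (H *ᵥ w)) ^ 2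

/-- **Lorentzian array** of degree `m` in `K` variables: nonnegative coefficients supported on `Δ(m,K)`,
M-convex support, and every `(m−2)`-nd partial derivative a quadratic form with at most one positive eigenvalue
(Brändén–Huh, Def. 2.6 / Thm. 2.25). -/
def IsLorentzianArray (m K : ℕ) (c : (Fin K → ℕ) → ℝ) : Prop :=
  (∀ α, 0 ≤ c α) ∧ (∀ α, α ∉ layer m K → c α = 0) ∧
    IsMConvexOn ((layer m K).filter (fun α => c α ≠ 0)) (fun _ => (0 : ℚ)) ∧
    ∀ γ ∈ layer (m - 2) K, AtMostOnePosEig (hessAt c γ)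

/-- sign `σ^α = Π_l σ_l^{α_l}` of the monomial `s^α` on the signed curve. -/
noncomputable def sgnMon {K : ℕ} (σ : Fin K → Bool) (α : Fin K → ℕ) : ℝ :=
  ∏ i, (if σ i then (1 : ℝ) else -1) ^ α i

/-- the restriction `g(x) = Σ_{α ∈ Δ(m,K)} σ^α c_α x^{⟨e,α⟩}` of `h = Σ c_α s^α` to the signed monomial curve
`s_l = σ_l x^{e_l}`. -/
noncomputable def curvePoly (m K : ℕ) (c : (Fin K → ℕ) → ℝ) (σ : Fin K → Bool) (e : Fin K → ℕ) : ℝ[X] :=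
  ∑ α ∈ layer m K, C (sgnMon σ α * c α) * X ^ wt e α

/-- **THE LAW of the line (crux-level stub) — Lorentzian Descartes law, B-shape.**  For some absolute `C`,
the signed monomial restriction of every Lorentzian polynomial of degree `m` in `K` variables with pairwise
distinct exponents has at most `2^(C (K + ⌊log₂ m⌋²))` distinct positive roots.  Strictly STRONGER than B for
the split class (`DetLorentzian`), hence than B and `MatrixDescartes` (composition below); NOT known to follow
from B (the Lorentzian class has dimension `|Δ(m,K)|`, the PSD-determinantal class `K·m(m+1)/2`).  WHY EASIER
(named tools): the Lorentzian class — unlike the determinantal one — is closed under the operations of the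
degeneration programme (initial forms on M-convex shadow cells, `∂_i`, `s_i ↦ 0`, nonnegative linear
substitutions, B–H Thm 2.10/Cor 2.32), its tropicalisation is EXACTLY the M-convex functions (B–H §3) where the
count is solved by `ShadowPathBound`, and the space of Lorentzian polynomials on a support is a closed ball
(B–H Thm 2.28: continuity-method available).  WHY IT MIGHT FAIL: the class is much larger than the determinantal
one; M-convexity constrains valuations, not archimedean cores, and Descartes-sharp Lorentzian supports at fat
formats (`2^{Ω(K log m)}` alternating realisable shadows with real-rooted cell polynomials) would kill it while
leaving B open. -/
def LorentzianDescartes : Prop :=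
  ∃ C : ℕ, ∀ (m K : ℕ) (c : (Fin K → ℕ) → ℝ) (σ : Fin K → Bool) (e : Fin K → ℕ),
    IsLorentzianArray m K c → Function.Injective e →
      posRoots (curvePoly m K c σ e) ≤ 2 ^ (C * (K + Nat.log 2 m ^ 2))

/-- the coefficient array of `det Σ_l s_l A_l`. -/
noncomputable def detArray (m K : ℕ) (A : Fin K → Matrix (Fin m) (Fin m) ℝ) : (Fin K → ℕ) → ℝ :=
  fun α => MvPolynomial.coeff (Finsupp.equivFunOnFinite.symm α)
    (Matrix.det (∑ l, (MvPolynomial.X l : MvPolynomial (Fin K) ℝ) • (A l).map MvPolynomial.C))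

/-- KNOWN (to formalise): `det Σ_l s_l A_l` with `A_l ⪰ 0` is real stable with nonnegative coefficients
(Borcea–Brändén 2009 Prop 2.4), hence Lorentzian (Brändén–Huh 2020, "stable polynomials with nonnegative
coefficients are Lorentzian", §2); its support is the set of lattice points of a generalized permutohedron. -/
def DetLorentzian : Prop :=
  ∀ (m K : ℕ) (A : Fin K → Matrix (Fin m) (Fin m) ℝ), (∀ l, (A l).PosSemidef) →
    IsLorentzianArray m K (detArray m K A)

/-- ALGEBRA (bookkeeping identity): the determinant of the signed split pencil is the curve restriction of the
coefficient array of `det Σ s_l A_l` (homogeneity of `det` of degree `m`). -/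
def DetCurve : Prop :=
  ∀ (m K : ℕ) (A : Fin K → Matrix (Fin m) (Fin m) ℝ) (σ : Fin K → Bool) (e : Fin K → ℕ),
    (pencil e (signed σ A)).det = curvePoly m K (detArray m K A) σ e

/-! ## Stubs (sorries live ONLY here) -/

/-- STUB (THE LAW; crux-level; XL). -/
theorem stub_lorentzianDescartes : LorentzianDescartes := by
  sorry

/-- STUB (KNOWN RESULT, formalisation M/L): Borcea–Brändén + Brändén–Huh. -/
theorem stub_detLorentzian : DetLorentzian := by
  -- LANDED (`…StubDetLorentzian`, `DetLorentzianAssembly.isLorentzianArray_detArray_of_posSemidef` = `DetLorentzian` unfolded): by-name citation, δ-unfold (stub-credit wiring val-port-1 g1, val-lit RULING #246 (a))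
  exact Summit.ValiantsHypothesis.ValiantsHypothesis.Theorems.LacunarySymmetroidMatrixDescartes.DetLorentzianAssembly.isLorentzianArray_detArray_of_posSemidef

/-- STUB (S/M, algebra): expansion of `det` of the signed split pencil along the layer `Δ(m,K)`. -/
theorem stub_detCurve : DetCurve := by
  -- LANDED (`…StubDetCurve`, `DetCurve.stub_detCurve` = `DetCurve` unfolded): by-name citation, δ-unfold (stub-credit wiring val-port-1 g1, val-lit RULING #246 (a))
  exact Summit.ValiantsHypothesis.ValiantsHypothesis.Theorems.LacunarySymmetroidMatrixDescartes.DetCurve.stub_detCurve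

/-- STUB (L; SHARED with line `sign-split`, `stub_perturb`). -/
theorem stub_perturbT8 : PerturbToAlternation := by
  -- LANDED (`…StubPerturbGeneric`, `Perturb.perturbToAlternation`): by-name citation, δ-unfold (stub-credit wiring val-port-1 g1, val-lit RULING #246 (a))
  exact Summit.ValiantsHypothesis.ValiantsHypothesis.Theorems.LacunarySymmetroidMatrixDescartes.Perturb.perturbToAlternation

/-- STUB (M; SHARED with line `sign-split`, `stub_split`). -/
theorem stub_splitT8 : SplitToSemidefinite := by
  -- LANDED (`…StubSplit`, `stub_split`): by-name citation, δ-unfold (stub-credit wiring val-port-1 g1, val-lit RULING #246 (a))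
  exact Summit.ValiantsHypothesis.ValiantsHypothesis.Theorems.LacunarySymmetroidMatrixDescartes.stub_split

/-- FIRST RUNG — CLOSED BY NAME (no longer a stub): proved for all `(m, K)` in
`Theorems/LacunarySymmetroidMatrixDescartesShadowPathBound.lean` (p584842, seat val-width-18050-ls1,
2026-08-27; rank-potential / gross-substitutes argument from the exchange axiom); the Theorems statement
is `ShadowPathBound` unfolded, definitionally equal, hence `exact`.  Format instances `(3,4), (4,4),
(2,6)`: `…ShadowPathBoundFormats.lean`. -/
theorem stub_shadowPath : ShadowPathBound := by
  exact Summit.ValiantsHypothesis.ValiantsHypothesis.Theorems.LacunarySymmetroidMatrixDescartes.shadowPathBound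

/-! ## Glue (proved) -/

/-- row `K = 0`: an empty pencil has determinant `1` (`m = 0`) or `0` (`m ≥ 1`); no counted roots. -/
theorem realRootLawAt_noTerms (m B : ℕ) : RealRootLawAt m 0 B := by
  intro d S hS
  have h0 : (∑ l : Fin 0, ((Polynomial.X : Polynomial ℝ) ^ d l) • (S l).map Polynomial.C) = 0 := by simp
  rw [h0]
  rcases Nat.eq_zero_or_pos m with hm | hm
  · subst hm
    simp
  · haveI : Nonempty (Fin m) := ⟨⟨0, hm⟩⟩
    rw [Matrix.det_zero]
    simp

/-- **Split-class law from the Lorentzian law** (B-shape bound for `Σ_l σ_l x^{d'_l} A_l`, `A_l ⪰ 0`,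
distinct exponents). -/
theorem splitLaw_of (hLD : LorentzianDescartes) (hDL : DetLorentzian) (hDC : DetCurve) :
    ∃ C : ℕ, ∀ (m K' : ℕ) (d' : Fin K' → ℕ) (σ : Fin K' → Bool) (A : Fin K' → Matrix (Fin m) (Fin m) ℝ),
      StrictMono d' → (∀ l, (A l).PosSemidef) →
        posRootCount d' (signed σ A) ≤ 2 ^ (C * (K' + Nat.log 2 m ^ 2)) := by
  obtain ⟨C, hC⟩ := hLD
  refine ⟨C, fun m K' d' σ A hd' hA => ?_⟩
  have h1 := hC m K' (detArray m K' A) σ d' (hDL m K' A hA) hd'.injective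
  unfold posRootCount
  rw [hDC m K' A σ d']
  exact h1

/-- **Conjecture B from the stubs' statements** (constant `2C + 3`). -/
theorem kPlusLogSqLaw_of_statements (hLD : LorentzianDescartes) (hDL : DetLorentzian) (hDC : DetCurve)
    (hP : PerturbToAlternation) (hS : SplitToSemidefinite) : KPlusLogSqLaw := by
  obtain ⟨C, hC⟩ := splitLaw_of hLD hDL hDC
  refine ⟨2 * C + 3, fun m K => ?_⟩
  rcases Nat.eq_zero_or_pos K with hK | hK
  · subst hK
    exact realRootLawAt_noTerms m _
  set E : ℕ := C * (2 * K + Nat.log 2 m ^ 2) with hE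
  -- Step A: every alternation datum of a symmetric pencil of format (m, K, d) has length ≤ 2^E
  have hsplitB : ∀ (d : Fin K → ℕ) (S' : Fin K → Matrix (Fin m) (Fin m) ℝ), (∀ l, (S' l).IsSymm) →
      ∀ (N : ℕ) (τ : Fin (N + 1) → ℝ), Alternates d S' N τ → N ≤ 2 ^ E := by
    intro d S' hS' N τ hAlt
    obtain ⟨K', d', σ, A, hK', hd', hA', hN⟩ := hS K m d S' hS' N τ hAlt
    refine hN.trans ((hC m K' d' σ A hd' hA').trans (Nat.pow_le_pow_right (by norm_num) ?_))
    rw [hE]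
    exact Nat.mul_le_mul_left _ (by omega)
  -- Step B: positive roots of every symmetric pencil
  have hpos : PosRootLawAt m K (2 * 2 ^ E) := by
    intro d S hSy
    have h := hP K m d (2 ^ E) (hsplitB d) S hSy
    exact h
  -- Step C: all real roots, then the arithmetic `4·2^E + 1 ≤ 2^{(2C+3)(K+L²)}`
  have hreal : RealRootLawAt m K (2 * (2 * 2 ^ E) + 1) := Census.realRootLawAt_of_posRootLawAt hpos
  refine Census.realRootLawAt_mono ?_ hreal
  have hE' : E ≤ 2 * C * (K + Nat.log 2 m ^ 2) := by
    rw [hE]; nlinarith [Nat.zero_le (C * Nat.log 2 m ^ 2)]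
  have h3 : 3 ≤ 3 * (K + Nat.log 2 m ^ 2) := by nlinarith
  calc 2 * (2 * 2 ^ E) + 1 ≤ 2 ^ E * 8 := by
        have : 1 ≤ 2 ^ E := Nat.one_le_two_pow
        omega
    _ = 2 ^ (E + 3) := by rw [pow_add]; norm_num
    _ ≤ 2 ^ ((2 * C + 3) * (K + Nat.log 2 m ^ 2)) := Nat.pow_le_pow_right (by norm_num) (by nlinarith)

/-- **Conjecture B, by name, from the stubs.** -/
theorem kPlusLogSqLaw_of : KPlusLogSqLaw :=
  kPlusLogSqLaw_of_statements stub_lorentzianDescartes stub_detLorentzian stub_detCurve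
    stub_perturbT8 stub_splitT8

/-- **The line's composition: the crux `MatrixDescartes`, by name, from the stubs** (last arrow = the tree
bridge `Census.matrixDescartes_of_kPlusLogSqLaw`). -/
theorem MatrixDescartes_of :
    Summit.ValiantsHypothesis.ValiantsHypothesis.Theses.LacunarySymmetroid.MatrixDescartes :=
  Census.matrixDescartes_of_kPlusLogSqLaw kPlusLogSqLaw_of

/-! ## Honesty lemmas (proved): where the rung and the law sit -/

/-- B ⇒ the split-class law with the SAME constant (a split pencil is a symmetric pencil with `K'` terms):
the split-class law alone is B restated (same wall); the line's law is the LORENTZIAN one. -/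
theorem splitLaw_of_kPlusLogSqLaw (hB : KPlusLogSqLaw) (hDC : DetCurve) :
    ∃ C : ℕ, ∀ (m K' : ℕ) (d' : Fin K' → ℕ) (σ : Fin K' → Bool) (A : Fin K' → Matrix (Fin m) (Fin m) ℝ),
      (∀ l, (A l).PosSemidef) → posRootCount d' (signed σ A) ≤ 2 ^ (C * (K' + Nat.log 2 m ^ 2)) := by
  obtain ⟨C, hC⟩ := hB
  refine ⟨C, fun m K' d' σ A hA => ?_⟩
  have hsym : ∀ l, (signed σ A l).IsSymm := fun l => by
    have h' : (A l)ᵀ = A l := by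
      simpa [Matrix.conjTranspose_eq_transpose_of_trivial] using (hA l).1.eq
    exact (show (A l).IsSymm from h').smul _
  have h := hC m K' d' (signed σ A) hsym
  exact (Finset.card_filter_le _ _).trans h

end Summit.ValiantsHypothesis.ValiantsHypothesis.Cruxes.MatrixDescartes.LorentzianShadow
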